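import Summits.Ventures.HSemireg.WedgeHankelRecurrenceGaussChebyshevWeights

/-!
# Venture HSemireg — **UNIQUENESS OF THE GAUSS–RADAU RULE: THE INTERIOR NODES ARE FORCED**: any rule with `t + 2` nodes, one of them a prescribed `c`, that is exact to degree `2t + 2` for a
# discrete measure `M` on nodes `V` has its other nodes' polynomial `∏ (X − w_k)` ORTHOGONAL to all polynomials of degree `≤ t` for the modified measure `(V − c)·M`; hence (for `c` left of the
# support) it is the Gauss node polynomial of `(V − c)·M` — the rule of N276 — and two such rules have the same interior nodes

HONEST FRAMING. Part of the Lean index of the computation cell `pub-hsemireg` (seat p10 gen 44, Sunday typer «UNIFORM-IN-n»).  Real polynomials and finite sums only; no variety, no cohomology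
theory, no sheaf, no Ext group and no semiregularity map is constructed here; nothing here says that HC / HC_CM / HC_AV holds; no Literature fact (unproved `Prop`) is declared or used.  Custodian
versions as in `WedgeHankelSiegelIdeal` (1/3).
SOURCES (cited).  R. Radau, *Étude sur les formules d'approximation qui servent à calculer la valeur numérique d'une intégrale définie*, J. Math. Pures Appl. (3) 6 (1880) 283–336; W. Gautschi,
*Orthogonal Polynomials: Computation and Approximation* (2004) §1.4.2, Thm 1.48 ∕ (1.4.19) (Gauss–Radau: the free nodes are the zeros of `π_n(·; (t − a)dλ)`); P. J. Davis, P. Rabinowitz,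
*Methods of Numerical Integration* (2nd ed.) §2.7.1.
PROOF TYPED HERE.  Exactness applied to `F = (X − c)·∏(X − w_k)·G` (degree `≤ 2t + 2`), which vanishes at every node of the rule; uniqueness of the monic orthogonal polynomial (N290) for the positive
measure `(V − c)M`; identification with N276 via N265 `sum_mul_eval_nodePoly_mul_eq_zero`.
DEDUP DISCLOSURE (`rg -n 'radau' Summits/Ventures/HSemireg`, 2026-09-03): N276 CONSTRUCTS the Radau rule from the Gauss rule of `(V − c)M` (existence, exactness, positivity); the converse
(uniqueness ∕ forced interior nodes) is new.  The 3 names below: 0 hits tree-wide.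

WHAT IS IN THE TREE.  N263 `sum_mul_eval_eq_of_moments_eq`; N290 `orthogonal_monic_unique`; N265 `sum_mul_eval_nodePoly_mul_eq_zero`; N276 `gauss_radau`.
THIS FILE (namespace `Summit.Ventures.HSemireg.Wedge.HankelOuter` continued; CHAINED on N342 (import only); 0 definitions):
* §1108 **`radau_interior_orthogonal`** (exactness to degree `2t + 2` with the node `c` ⇒ `∏(X − w_k) ⟂ G` for the measure `(V − c)M`, `deg G ≤ t`), **`radau_interior_unique`** (two such rules with
  `c < V_l` have the same `∏(X − w_k)`), **`radau_interior_eq_gauss_modified`** (it is the Gauss node polynomial of `(V − c)M`).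
CAVEATS.  Discrete positive measures; for the uniqueness `c < V_l` for all `l` (so that `(V − c)M > 0`) and `t + 1 ≤ P`.  Nothing Ext-side.  New names only.
-/

open Module Polynomial
open scoped Matrix Polynomial

namespace Summit.Ventures.HSemireg.Wedge.HankelOuter

/-! ## §1108. Uniqueness of the Gauss–Radau rule -/

/-- **A `(t+2)`-node rule through `c`, exact to degree `2t + 2`, has `∏(X − w_k)` orthogonal to degree `≤ t` for `(V − c)·M`.** [Gautschi Thm 1.48; this file, §1108] -/
theorem radau_interior_orthogonal {t P : ℕ} {M V : Fin P → ℝ} {c lc : ℝ} {lam w : Fin (t + 1) → ℝ}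
    (hex : ∀ p, p ≤ 2 * t + 2 → ∑ i : Fin (t + 2), (Fin.cons lc lam : Fin (t + 2) → ℝ) i * (Fin.cons c w : Fin (t + 2) → ℝ) i ^ p = ∑ l, M l * V l ^ p)
    {G : ℝ[X]} (hG : G.natDegree ≤ t) :
    ∑ l, (M l * (V l - c)) * ((∏ k, (Polynomial.X - C (w k))) * G).eval (V l) = 0 := by
  set F : ℝ[X] := (Polynomial.X - C c) * ((∏ k, (Polynomial.X - C (w k))) * G) with hF
  have hPi : (∏ k, (Polynomial.X - C (w k))).natDegree = t + 1 := by
    rw [natDegree_prod_of_monic _ _ (fun k _ => monic_X_sub_C _)]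
    simp only [natDegree_X_sub_C, Finset.sum_const, Finset.card_univ, Fintype.card_fin, smul_eq_mul, mul_one]
  have hFd : F.natDegree < 2 * t + 3 := by
    refine (natDegree_mul_le.trans (add_le_add (natDegree_X_sub_C c).le (natDegree_mul_le.trans (add_le_add hPi.le hG)))).trans_lt (by omega)
  have hmom : ∀ p, p < 2 * t + 3 → ∑ i : Fin (t + 2), (Fin.cons lc lam : Fin (t + 2) → ℝ) i * (Fin.cons c w : Fin (t + 2) → ℝ) i ^ p = ∑ l, M l * V l ^ p :=
    fun p hp => hex p (by omega)
  have h := sum_mul_eval_eq_of_moments_eq hmom hFd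
  -- `F` vanishes at every node of the rule
  have hzero : ∑ i : Fin (t + 2), (Fin.cons lc lam : Fin (t + 2) → ℝ) i * F.eval ((Fin.cons c w : Fin (t + 2) → ℝ) i) = 0 := by
    refine Finset.sum_eq_zero fun i _ => ?_
    refine Fin.cases ?_ (fun k => ?_) i
    · simp only [Fin.cons_zero, hF, eval_mul, eval_sub, eval_X, eval_C, sub_self, zero_mul, mul_zero]
    · simp only [Fin.cons_succ, hF, eval_mul, eval_prod]
      rw [Finset.prod_eq_zero (Finset.mem_univ k) (by rw [eval_sub, eval_X, eval_C, sub_self])]; ring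
  rw [hzero] at h
  rw [h]
  exact Finset.sum_congr rfl fun l _ => by simp only [hF, eval_mul, eval_sub, eval_X, eval_C]; ring

/-- **UNIQUENESS OF THE RADAU INTERIOR NODES: two `(t+2)`-node rules through the same `c < V_l`, both exact to degree `2t + 2`, have the same `∏(X − w_k)`.** [Radau 1880; Gautschi §1.4.2;
this file, §1108] -/
theorem radau_interior_unique {t P : ℕ} {M V : Fin P → ℝ} (hM : ∀ l, 0 < M l) (hV : Function.Injective V) (hP : t + 1 ≤ P) {c : ℝ} (hcV : ∀ l, c < V l)
    {lc lc' : ℝ} {lam w lam' w' : Fin (t + 1) → ℝ}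
    (hex : ∀ p, p ≤ 2 * t + 2 → ∑ i : Fin (t + 2), (Fin.cons lc lam : Fin (t + 2) → ℝ) i * (Fin.cons c w : Fin (t + 2) → ℝ) i ^ p = ∑ l, M l * V l ^ p)
    (hex' : ∀ p, p ≤ 2 * t + 2 → ∑ i : Fin (t + 2), (Fin.cons lc' lam' : Fin (t + 2) → ℝ) i * (Fin.cons c w' : Fin (t + 2) → ℝ) i ^ p = ∑ l, M l * V l ^ p) :
    ∏ k, (Polynomial.X - C (w k)) = ∏ k, (Polynomial.X - C (w' k)) := by
  have hdeg : ∀ u : Fin (t + 1) → ℝ, (∏ k, (Polynomial.X - C (u k))).natDegree = t + 1 := fun u => by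
    rw [natDegree_prod_of_monic _ _ (fun k _ => monic_X_sub_C _)]
    simp only [natDegree_X_sub_C, Finset.sum_const, Finset.card_univ, Fintype.card_fin, smul_eq_mul, mul_one]
  exact orthogonal_monic_unique (ν := fun l => M l * (V l - c)) (fun l => mul_pos (hM l) (sub_pos.2 (hcV l))) hV hP
    (monic_prod_of_monic _ _ fun k _ => monic_X_sub_C _) (hdeg w) (monic_prod_of_monic _ _ fun k _ => monic_X_sub_C _) (hdeg w')
    (fun G hG => radau_interior_orthogonal hex (by omega)) (fun G hG => radau_interior_orthogonal hex' (by omega))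

/-- **THE RADAU INTERIOR NODES ARE THE GAUSS NODES OF `(V − c)·M`**: if `(ν', w')` is the `(t+1)`-point Gauss rule of the modified measure (as in N276) then any exact `(t+2)`-node rule through `c`
has `∏(X − w_k) = ∏(X − w'_k)`. [Gautschi (1.4.19); Davis–Rabinowitz §2.7.1; this file, §1108] -/
theorem radau_interior_eq_gauss_modified {t P : ℕ} {M V : Fin P → ℝ} (hM : ∀ l, 0 < M l) (hV : Function.Injective V) (hP : t + 1 ≤ P) {c : ℝ} (hcV : ∀ l, c < V l)
    {ν' w' : Fin (t + 1) → ℝ} (hB : ∀ p, p ≤ 2 * t + 1 → ∑ l, ν' l * w' l ^ p = ∑ l, (M l * (V l - c)) * V l ^ p)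
    {lc : ℝ} {lam w : Fin (t + 1) → ℝ}
    (hex : ∀ p, p ≤ 2 * t + 2 → ∑ i : Fin (t + 2), (Fin.cons lc lam : Fin (t + 2) → ℝ) i * (Fin.cons c w : Fin (t + 2) → ℝ) i ^ p = ∑ l, M l * V l ^ p) :
    ∏ k, (Polynomial.X - C (w k)) = ∏ k, (Polynomial.X - C (w' k)) := by
  have hdeg : ∀ u : Fin (t + 1) → ℝ, (∏ k, (Polynomial.X - C (u k))).natDegree = t + 1 := fun u => by
    rw [natDegree_prod_of_monic _ _ (fun k _ => monic_X_sub_C _)]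
    simp only [natDegree_X_sub_C, Finset.sum_const, Finset.card_univ, Fintype.card_fin, smul_eq_mul, mul_one]
  exact orthogonal_monic_unique (ν := fun l => M l * (V l - c)) (fun l => mul_pos (hM l) (sub_pos.2 (hcV l))) hV hP
    (monic_prod_of_monic _ _ fun k _ => monic_X_sub_C _) (hdeg w) (monic_prod_of_monic _ _ fun k _ => monic_X_sub_C _) (hdeg w')
    (fun G hG => radau_interior_orthogonal hex (by omega)) (fun G hG => sum_mul_eval_nodePoly_mul_eq_zero hB (by omega))

end Summit.Ventures.HSemireg.Wedge.HankelOuter
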